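import Mathlib

/-!
# Route `UnitScaleTilt` — crux K2-L `HistoryTailL` (stmt-QuantumFields-19936), STUB 4c `stub_diluteExponent`: THE CLUSTER LEMMA — a connected cluster of
# large-field plaquettes that serves `m ≥ 2` members of a `ρ`-separated family has at least `μ·m` plaquettes (support file; abstract combinatorics of walks in
# a graph with a Lipschitz height, no lattice objects)

Fleet lead `ym-ust-18916-p1` (gen 3), 2026-08-27.  In the dilute-family exponent bound ([Balaban1985UV3] (70)–(71) p.273 for a SEPARATED FAMILY `S` of large
plaquettes), each non-deep member `q ∈ S` is served by a large-field plaquette `c(q)` of the history within the reach `R` of the collar chain; the plaquettes of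
one level are grouped into the connected components («clusters») of the overlap graph (`c ~ c′` iff their corner blocks `Δ′` can overlap, which forces their
distance `≤ δ`).  The action of the union of a cluster's corner blocks is at least `1/μ₀` of the sum of the localised actions (multiplicity, `CornerBlocks`) and at
least one of them; so a cluster `Γ` of `n` plaquettes serving `m` members must have `n ≥ μ₀·m` as soon as `m ≥ 2` — which is what this file proves, abstractly:

* §1 `exists_getVert_crossing` — along a walk whose height `f` rises from `≤ t` to `> t`, with `|f(a) − f(b)| ≤ δ` on edges, some vertex has `t < f ≤ t + δ`;
  `le_card_shells` — if the height rises from `≤ t₀` to `≥ t₀ + n·δ`, the walk has `n` DISTINCT vertices with `t₀ < f ≤ t₀ + n·δ` (one per shell);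
* §2 **`cluster_card_ge`** — centres `C`, a graph whose edges join centres at distance `≤ δ`, members with sources in `C` within `R`, pairwise `ρ`-separated in the
  sense `ρ ≤ E q v + E q′ v` (no vertex is close to two members), `2R + 2μδ < ρ`: a component serving `m ≥ 2` members contains `≥ μ·m` centres;
  `members_le_max` — the form used: `m_Γ ≤ max 1 (n_Γ / μ)`.

References: T. Bałaban, CMP 102 (1985) 255–275 [Balaban1985UV3] ((70)–(71) p.273).
-/

noncomputable section

open scoped BigOperators

namespace Summit.QuantumFields.YangMills.Theorems.HistoryTailClusters

open Classical

/-! ## §1 Shells along a walk -/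

section Walks

variable {V : Type*} {G : SimpleGraph V}

/-- **CROSSING A LEVEL**: along a walk from `u` with `f u ≤ t` to `v` with `t < f v`, where `f` changes by at most `δ` across an edge, some vertex has
`t < f ≤ t + δ` (the first vertex above `t`). [folklore] -/
theorem exists_getVert_crossing {u v : V} (w : G.Walk u v) (f : V → ℝ) (δ : ℝ) (hδ : ∀ a b, G.Adj a b → f b ≤ f a + δ)
    (t : ℝ) (hu : f u ≤ t) (hv : t < f v) : ∃ i, i ≤ w.length ∧ t < f (w.getVert i) ∧ f (w.getVert i) ≤ t + δ := by
  have hex : ∃ i, t < f (w.getVert i) := ⟨w.length, by rwa [w.getVert_length]⟩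
  set n := Nat.find hex with hn
  have hnP : t < f (w.getVert n) := Nat.find_spec hex
  have hn0 : n ≠ 0 := by
    intro h0
    rw [h0, w.getVert_zero] at hnP
    exact absurd hnP (not_lt.mpr hu)
  obtain ⟨k, hk⟩ := Nat.exists_eq_succ_of_ne_zero hn0
  have hkP : ¬ t < f (w.getVert k) := Nat.find_min hex (by omega)
  have hnle : n ≤ w.length := by
    by_contra hlt
    have : w.getVert n = v := w.getVert_of_length_le (by omega)
    have hlen : w.getVert w.length = v := w.getVert_length
    exact absurd (Nat.find_min hex (show w.length < n by omega)) (by rw [hlen]; exact not_not.mpr hv)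
  have hklt : k < w.length := by omega
  have hadj : G.Adj (w.getVert k) (w.getVert (k + 1)) := w.adj_getVert_succ hklt
  refine ⟨n, hnle, hnP, ?_⟩
  rw [hk]
  have := hδ _ _ hadj
  linarith [not_lt.mp hkP]

/-- **ONE VERTEX PER SHELL**: if the height rises from `f u ≤ t₀` to `t₀ + n·δ ≤ f v` (`δ > 0`), the walk carries, for each `s < n`, a vertex with
`t₀ + s·δ < f ≤ t₀ + (s+1)·δ`; these are pairwise distinct, so at least `n` vertices of the walk have `t₀ < f ≤ t₀ + n·δ`. [folklore] -/
theorem le_card_shells [DecidableEq V] {u v : V} (w : G.Walk u v) (f : V → ℝ) {δ : ℝ} (hδ0 : 0 < δ)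
    (hδ : ∀ a b, G.Adj a b → f b ≤ f a + δ) (t₀ : ℝ) (n : ℕ) (hu : f u ≤ t₀) (hv : t₀ + n * δ ≤ f v) :
    n ≤ (w.support.toFinset.filter fun x => t₀ < f x ∧ f x ≤ t₀ + n * δ).card := by
  -- a vertex in each shell
  have hshell : ∀ s : ℕ, s < n → ∃ x ∈ w.support, t₀ + s * δ < f x ∧ f x ≤ t₀ + (s + 1) * δ := by
    intro s hs
    have hs1 : (s : ℝ) + 1 ≤ n := by exact_mod_cast hs
    have hvt : t₀ + s * δ < f v := by nlinarith
    have hut : f u ≤ t₀ + s * δ := by nlinarith [mul_nonneg (Nat.cast_nonneg s) hδ0.le]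
    obtain ⟨i, _, h1, h2⟩ := exists_getVert_crossing w f δ hδ (t₀ + s * δ) hut hvt
    exact ⟨w.getVert i, w.getVert_mem_support i, h1, by linarith⟩
  haveI : Nonempty V := ⟨u⟩
  choose! x hxmem hxlo hxhi using hshell
  have hinj : Set.InjOn x (Finset.range n : Set ℕ) := by
    intro s hs s' hs' hss'
    have hs := Finset.mem_range.mp hs
    have hs' := Finset.mem_range.mp hs'
    by_contra hne
    rcases Nat.lt_or_gt_of_ne hne with hlt | hlt
    · have h1 := hxhi s hs; have h2 := hxlo s' hs'
      rw [hss'] at h1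
      have : ((s : ℝ) + 1) * δ ≤ (s' : ℝ) * δ := mul_le_mul_of_nonneg_right (by exact_mod_cast hlt) hδ0.le
      linarith
    · have h1 := hxhi s' hs'; have h2 := hxlo s hs
      rw [← hss'] at h1
      have : ((s' : ℝ) + 1) * δ ≤ (s : ℝ) * δ := mul_le_mul_of_nonneg_right (by exact_mod_cast hlt) hδ0.le
      linarith
  calc n = (Finset.range n).card := (Finset.card_range n).symm
    _ = ((Finset.range n).image x).card := (Finset.card_image_of_injOn hinj).symm
    _ ≤ (w.support.toFinset.filter fun y => t₀ < f y ∧ f y ≤ t₀ + n * δ).card := by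
        refine Finset.card_le_card fun y hy => ?_
        obtain ⟨s, hs, rfl⟩ := Finset.mem_image.mp hy
        have hs := Finset.mem_range.mp hs
        refine Finset.mem_filter.mpr ⟨List.mem_toFinset.mpr (hxmem s hs), ?_, ?_⟩
        · have := hxlo s hs
          nlinarith [mul_nonneg (Nat.cast_nonneg s) hδ0.le]
        · have := hxhi s hs
          have hs1 : ((s : ℝ) + 1) * δ ≤ n * δ := mul_le_mul_of_nonneg_right (by exact_mod_cast hs) hδ0.le
          linarith

end Walks

/-! ## §2 The cluster lemma -/

section Clusters

variable {V β : Type*} [DecidableEq V] {G : SimpleGraph V}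

/-- **THE CLUSTER LEMMA**: centres `C ⊆ V`; a graph whose edges join centres and change each member's distance function `E q` by at most `δ > 0`; members
`M` with sources `ctr q ∈ C`, `E q (ctr q) ≤ R`; separation `ρ ≤ E q v + E q′ v` for distinct members and every vertex; `2R + 2μδ < ρ`.  Then a connected
component `Γ` whose centres serve `m ≥ 2` members contains at least `μ·m` centres: the walk from `ctr q` to another served source climbs from `E q ≤ R` to
`E q ≥ ρ − R ≥ R + μδ`, leaving `μ` distinct centres in the ball `E q ≤ R + μδ`, and these balls are disjoint for distinct members.
[cite: Balaban1985UV3, (70)-(71) p.273] -/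
theorem cluster_card_ge (C : Finset V) (hC : ∀ a b, G.Adj a b → b ∈ C) (M : Finset β) (ctr : β → V)
    (E : β → V → ℝ) {δ R ρ : ℝ} (hδ0 : 0 < δ) (hE : ∀ q a b, G.Adj a b → E q b ≤ E q a + δ) (hR : ∀ q ∈ M, E q (ctr q) ≤ R)
    (hsep : ∀ q ∈ M, ∀ q' ∈ M, q ≠ q' → ∀ v, ρ ≤ E q v + E q' v) (μ : ℕ) (hρ : 2 * R + 2 * μ * δ < ρ)
    (Γ : G.ConnectedComponent) (hm : 2 ≤ (M.filter fun q => G.connectedComponentMk (ctr q) = Γ).card) :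
    μ * (M.filter fun q => G.connectedComponentMk (ctr q) = Γ).card ≤ (C.filter fun c => G.connectedComponentMk c = Γ).card := by
  set MΓ := M.filter fun q => G.connectedComponentMk (ctr q) = Γ with hMΓ
  set CΓ := C.filter fun c => G.connectedComponentMk c = Γ with hCΓ
  -- the ball of a served member inside the cluster
  let B : β → Finset V := fun q => CΓ.filter fun x => E q x ≤ R + μ * δ
  -- (1) each ball has at least `μ` centres
  have hball : ∀ q ∈ MΓ, μ ≤ (B q).card := by
    intro q hq
    obtain ⟨hqM, hqΓ⟩ := Finset.mem_filter.mp hq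
    -- another member served by the cluster
    obtain ⟨q', hq', hne⟩ : ∃ q' ∈ MΓ, q' ≠ q := by
      by_contra hno
      push Not at hno
      have : MΓ ⊆ {q} := fun q'' hq'' => Finset.mem_singleton.mpr (hno q'' hq'')
      have := Finset.card_le_card this
      rw [Finset.card_singleton] at this
      omega
    obtain ⟨hq'M, hq'Γ⟩ := Finset.mem_filter.mp hq'
    -- a walk from `ctr q` to `ctr q'`
    have hreach : G.Reachable (ctr q) (ctr q') := SimpleGraph.ConnectedComponent.exact (hqΓ.trans hq'Γ.symm)
    obtain ⟨w⟩ := hreach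
    have hstart : E q (ctr q) ≤ R := hR q hqM
    have hend : R + μ * δ ≤ E q (ctr q') := by
      have h1 := hsep q hqM q' hq'M hne.symm (ctr q')
      have h2 := hR q' hq'M
      have h3 : (0 : ℝ) ≤ (μ : ℝ) * δ := mul_nonneg (Nat.cast_nonneg _) hδ0.le
      linarith
    have hcount := le_card_shells w (E q) hδ0 (fun a b hab => hE q a b hab) R μ hstart (by simpa using hend)
    refine hcount.trans (Finset.card_le_card fun x hx => ?_)
    obtain ⟨hxw, hxlo, hxhi⟩ := Finset.mem_filter.mp hx
    have hxw' : x ∈ w.support := List.mem_toFinset.mp hxw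
    refine Finset.mem_filter.mpr ⟨Finset.mem_filter.mpr ⟨?_, ?_⟩, hxhi⟩
    · -- `x ∈ C`: it is not the start (its height exceeds `R`), so it is entered through an edge
      obtain ⟨i, rfl, hi⟩ := SimpleGraph.Walk.mem_support_iff_exists_getVert.mp hxw'
      have hi0 : i ≠ 0 := by
        intro h0
        rw [h0, w.getVert_zero] at hxlo
        linarith
      obtain ⟨k, rfl⟩ := Nat.exists_eq_succ_of_ne_zero hi0
      exact hC _ _ (w.adj_getVert_succ (by omega))
    · -- `x ∈ Γ`: reachable from `ctr q`
      have hxr : G.Reachable (ctr q) x := ⟨w.takeUntil x hxw'⟩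
      rw [← hqΓ]
      exact (SimpleGraph.ConnectedComponent.sound hxr).symm
  -- (2) the balls of distinct served members are disjoint
  have hdisj : ∀ q ∈ MΓ, ∀ q' ∈ MΓ, q ≠ q' → Disjoint (B q) (B q') := by
    intro q hq q' hq' hne
    rw [Finset.disjoint_left]
    intro x hx hx'
    have h1 := (Finset.mem_filter.mp hx).2
    have h2 := (Finset.mem_filter.mp hx').2
    have h3 := hsep q (Finset.mem_filter.mp hq).1 q' (Finset.mem_filter.mp hq').1 hne x
    linarith
  -- (3) count
  calc μ * MΓ.card = ∑ _q ∈ MΓ, μ := by rw [Finset.sum_const, smul_eq_mul, mul_comm]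
    _ ≤ ∑ q ∈ MΓ, (B q).card := Finset.sum_le_sum hball
    _ = (MΓ.biUnion B).card := (Finset.card_biUnion hdisj).symm
    _ ≤ CΓ.card := Finset.card_le_card (Finset.biUnion_subset.mpr fun q _ => Finset.filter_subset _ _)

/-- **THE FORM USED**: under the hypotheses of `cluster_card_ge`, the number of members served by a cluster is at most `max 1 (n_Γ / μ)`.
[cite: Balaban1985UV3, (70)-(71) p.273] -/
theorem members_le_max (C : Finset V) (hC : ∀ a b, G.Adj a b → b ∈ C) (M : Finset β) (ctr : β → V)
    (E : β → V → ℝ) {δ R ρ : ℝ} (hδ0 : 0 < δ) (hE : ∀ q a b, G.Adj a b → E q b ≤ E q a + δ) (hR : ∀ q ∈ M, E q (ctr q) ≤ R)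
    (hsep : ∀ q ∈ M, ∀ q' ∈ M, q ≠ q' → ∀ v, ρ ≤ E q v + E q' v) (μ : ℕ) (hμ : 0 < μ) (hρ : 2 * R + 2 * μ * δ < ρ)
    (Γ : G.ConnectedComponent) :
    ((M.filter fun q => G.connectedComponentMk (ctr q) = Γ).card : ℝ) ≤
      max 1 (((C.filter fun c => G.connectedComponentMk c = Γ).card : ℝ) / μ) := by
  set m := (M.filter fun q => G.connectedComponentMk (ctr q) = Γ).card with hm
  by_cases h2 : 2 ≤ m
  · have h := cluster_card_ge C hC M ctr E hδ0 hE hR hsep μ hρ Γ h2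
    have hμ' : (0 : ℝ) < μ := by exact_mod_cast hμ
    refine le_trans ?_ (le_max_right _ _)
    rw [le_div_iff₀ hμ']
    rw [← hm] at h
    exact_mod_cast (by rw [mul_comm]; exact h)
  · exact le_trans (by exact_mod_cast (by omega : m ≤ 1)) (le_max_left _ _)

end Clusters

end Summit.QuantumFields.YangMills.Theorems.HistoryTailClusters

end
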